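import Mathlib
import HarnessLib

/-!
# An explicit half-line barrier for the drift `c/√(T−t)` (Zhang 2026, κ = 1), I: the Riccati inequality

Helper toward the crux `AxisymSwirlRegular` (stmt-NavierStokesRegularity-1964, route TypeIIInviscidRelaxation),
registered line `radial_inflow_split`, criterion side `stub_oneSidedRadialCriterion` (⟨19059⟩).

The tree reduces Q. S. Zhang's partial Type I theorem (`Literature.Analysis.FluidPDE.Zhang2026_partialTypeI_regularity`,
arXiv:2604.07785 Thm 1.1: axisymmetric Leray–Hopf solutions with `v_r ≥ −c/√(T−t)` do not blow up at `T`) to ONE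
statement of real analysis (`RadialInflowComparisonT.zhang2026_partialTypeI_of_barrier`): for every `c, T > 0` a
time-dependent half-line barrier `w(r,t)` on `(0,2) × (0,T)` with `w_rr − w_r/r + (c/√(T−t)) w_r ≤ w_t`, `w(0,t) = 0`,
`w(·,t)` nondecreasing, `w ≤ C r^α` on `[0,1]`, `w(1,t) ≥ 1`, `w(r,0) ≥ min(r,1)²`.  Zhang obtains the modulus
abstractly (De Giorgi–Nash–Moser boundary regularity on a time-dependent domain, §2 of the paper); the tree's
interface wants an explicit `C²` supersolution.  This file and its three siblings (`…ZhangBarrierProfile`,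
`…ZhangBarrierProfileBounds`, `…ZhangBarrier`) construct one:
`w(r,t) = Λ (T−t)^m F(r/√(T−t))` with the similarity profile `F = u·v`,
`u(ξ) = 1 − e^{−λξ}(1+λξ)` (`λ = c+1`, exact solution of `u″ + (λ − 1/ξ)u′ = 0`), `v = exp(m ψ)`,
`ψ′ = φ(ξ) = A e^{−cξ} + 2/√(1+(ξ−2c)²)`, `A = 8e^{2c²+c}`, `m = 1/(16(A+2))`, `α = 2m`.

THIS FILE: the constants and the scalar heart of the construction, the Riccati inequality
`φ′ + (c − 1/ξ − ξ/2)φ + mφ² ≤ −1` on `(0,∞)` (`riccati_le`): on `ξ ≥ 2c+1` the algebraic tail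
`2/√(1+(ξ−2c)²) ≈ 2/(ξ−2c)` (the outer solution `(ξ−2c)^{2m}` in logarithmic form) is a strict supersolution by
itself (`tail_region_one`); on `ξ < 2c+1` the exponential part pays for the outward drift,
`A e^{−cξ}(1/ξ + ξ/2 − 1/8) ≥ 7 ≥ 1 + 13/4` (`tail_region_two`).  The exponent `m` is tiny (of the order of the
killing rate `e^{−2c²}` of the comparison diffusion) and not optimised.

Pure Mathlib real analysis; no NS statement here.
References: Qi S. Zhang, arXiv:2604.07785 (2026), §2 (the one-dimensional comparison problem) [Zhang2026PartialTypeI].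
-/

noncomputable section

set_option linter.dupNamespace false

open Set Filter Topology Real

namespace Summit.NavierStokesRegularity.NavierStokesRegularity.Theorems.ZhangBarrier

/-! ## §1 Constants and the Riccati inequality -/

/-- The amplitude `A(c) = 8 e^{2c²+c}` of the exponential part of `φ`. [new] -/
def bigA (c : ℝ) : ℝ := 8 * exp (2 * c ^ 2 + c)

/-- The exponent `m(c) = 1/(16(A(c)+2))`; the barrier's Hölder exponent is `α = 2m`. [new] -/
def expo (c : ℝ) : ℝ := 1 / (16 * (bigA c + 2))

/-- `φ(ξ) = A e^{−cξ} + 2/√(1+(ξ−2c)²)`, the logarithmic derivative profile of `v`. [new] -/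
def phi (c ξ : ℝ) : ℝ := bigA c * exp (-(c * ξ)) + 2 / √(1 + (ξ - 2 * c) ^ 2)

/-- `φ′(ξ) = −cA e^{−cξ} − 2(ξ−2c)/√(1+(ξ−2c)²)³`. [new] -/
def dphi (c ξ : ℝ) : ℝ :=
  -(c * bigA c * exp (-(c * ξ))) - 2 * (ξ - 2 * c) / √(1 + (ξ - 2 * c) ^ 2) ^ 3

/-- `A > 0`. -/
theorem bigA_pos (c : ℝ) : 0 < bigA c := by unfold bigA; positivity

/-- `m > 0`. -/
theorem expo_pos (c : ℝ) : 0 < expo c := by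
  unfold expo; have := bigA_pos c; positivity

/-- `16(A+2)·m = 1`. -/
theorem expo_mul (c : ℝ) : 16 * (bigA c + 2) * expo c = 1 := by
  unfold expo; have := bigA_pos c; field_simp

/-- `32 m ≤ 1` (so `m ≤ 1/32`, `α = 2m ≤ 1/16`). -/
theorem expo_le (c : ℝ) : 32 * expo c ≤ 1 := by
  have hA := bigA_pos c
  have h := expo_mul c
  nlinarith [expo_pos c]

/-- `φ > 0`. -/
theorem phi_pos (c ξ : ℝ) : 0 < phi c ξ := by
  unfold phi; have := bigA_pos c; positivity

/-- `φ ≤ A + 2`. -/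
theorem phi_le (c ξ : ℝ) (hc : 0 < c) (hξ : 0 ≤ ξ) : phi c ξ ≤ bigA c + 2 := by
  unfold phi
  have hA := bigA_pos c
  have hE : exp (-(c * ξ)) ≤ 1 := by
    rw [exp_le_one_iff]; nlinarith
  have hS : 1 ≤ √(1 + (ξ - 2 * c) ^ 2) := by
    rw [le_sqrt (by norm_num) (by positivity)]; nlinarith
  have h1 : bigA c * exp (-(c * ξ)) ≤ bigA c := by nlinarith [exp_pos (-(c * ξ))]
  have h2 : 2 / √(1 + (ξ - 2 * c) ^ 2) ≤ 2 := by
    rw [div_le_iff₀ (by positivity)]; nlinarith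
  linarith

/-- Region `ξ ≥ 2c+1` of the Riccati inequality: the algebraic tail alone is a strict supersolution,
`−2y/S³ − y/S + 8m/S² ≤ −1` for `S = √(1+y²)`, `y ≥ 1`, `16m ≤ 1`. -/
theorem tail_region_one {S y m : ℝ} (hS : 0 < S) (hSy : S ^ 2 = 1 + y ^ 2) (hy : 1 ≤ y)
    (hm : 16 * m ≤ 1) :
    -(2 * y) / S ^ 3 - y / S + 8 * m / S ^ 2 ≤ -1 := by
  have hyS : y ≤ S := by nlinarith
  have hS2y : S ≤ 2 * y := by nlinarith
  have hprod : (S - y) * (S + y) = 1 := by nlinarith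
  have hSy0 : 0 ≤ S - y := by linarith
  have h1 : 2 * y * (S - y) ≤ 1 := by nlinarith
  have h2 : 2 * y * (S - y) * (1 + y ^ 2) ≤ 1 + y ^ 2 := by nlinarith
  have h3 : 16 * m * (y * S) ≤ 2 * y ^ 2 := by
    have : y * S ≤ 2 * y ^ 2 := by nlinarith
    have : 16 * m * (y * S) ≤ 1 * (y * S) := by
      apply mul_le_mul_of_nonneg_right hm; positivity
    linarith
  have key : 2 * y * (-(2 * y) - y * S ^ 2 + 8 * m * S + S ^ 3) ≤ 0 := by
    have e : -(2 * y) - y * S ^ 2 + 8 * m * S + S ^ 3 = (S - y) * (1 + y ^ 2) - 2 * y + 8 * m * S := by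
      rw [show S ^ 3 = S * S ^ 2 by ring, hSy]; ring
    rw [e]; nlinarith
  have key' : -(2 * y) - y * S ^ 2 + 8 * m * S + S ^ 3 ≤ 0 := by
    by_contra h
    push Not at h
    nlinarith [mul_pos (by linarith : (0 : ℝ) < 2 * y) h]
  have e2 : -(2 * y) / S ^ 3 - y / S + 8 * m / S ^ 2 = (-(2 * y) - y * S ^ 2 + 8 * m * S) / S ^ 3 := by
    rw [eq_div_iff (by positivity)]
    field_simp
  rw [e2, div_le_iff₀ (by positivity)]
  linarith

/-- Region `ξ < 2c+1`: the tail's contribution is bounded, `−2y/S³ − y/S + 8m/S² ≤ 13/4`. -/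
theorem tail_region_two {S y m : ℝ} (hS : 0 < S) (hSy : S ^ 2 = 1 + y ^ 2)
    (hm : 32 * m ≤ 1) : -(2 * y) / S ^ 3 - y / S + 8 * m / S ^ 2 ≤ 13 / 4 := by
  have hS1 : 1 ≤ S := by nlinarith
  have hyS : -y ≤ S := by nlinarith
  have h1 : -(2 * y) / S ^ 3 ≤ 2 := by
    rw [div_le_iff₀ (by positivity)]; nlinarith
  have h2 : -(y / S) ≤ 1 := by
    rw [← neg_div, div_le_iff₀ hS]; linarith
  have h3 : 8 * m / S ^ 2 ≤ 1 / 4 := by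
    rw [div_le_iff₀ (by positivity)]; nlinarith
  linarith

set_option maxHeartbeats 400000 in
/-- **The Riccati inequality** `φ′ + (c − 1/ξ − ξ/2)φ + mφ² ≤ −1` on `(0,∞)`, for `φ = phi c`, `m = expo c`.
On `ξ − 2c ≥ 1` the tail alone does it (`tail_region_one`; the exponential part only helps since
`1/ξ + ξ/2 ≥ 1 ≥ 1/8`); on `ξ < 2c+1` the exponential part gives `A e^{−cξ}(1/ξ+ξ/2−1/8) ≥ 8·7/8 = 7`, which
pays for `1 + 13/4`. [new] -/
theorem riccati_le {c : ℝ} (hc : 0 < c) {ξ : ℝ} (hξ : 0 < ξ) :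
    dphi c ξ + (c - ξ⁻¹ - ξ / 2) * phi c ξ + expo c * phi c ξ ^ 2 ≤ -1 := by
  set A := bigA c with hA_def
  set m := expo c with hm_def
  set E := exp (-(c * ξ)) with hE_def
  set y := ξ - 2 * c with hy_def
  set S := √(1 + (ξ - 2 * c) ^ 2) with hS_def
  have hA : 0 < A := bigA_pos c
  have hm0 : 0 < m := expo_pos c
  have hm32 : 32 * m ≤ 1 := expo_le c
  have hm16 : 16 * m ≤ 1 := by linarith
  have hmA : 16 * (A + 2) * m = 1 := expo_mul c
  have hE0 : 0 < E := exp_pos _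
  have hE1 : E ≤ 1 := by rw [hE_def, exp_le_one_iff]; nlinarith
  have hS0 : 0 < S := by rw [hS_def]; positivity
  have hSy : S ^ 2 = 1 + y ^ 2 := by rw [hS_def, sq_sqrt (by positivity)]
  have hξinv : 1 ≤ ξ⁻¹ + ξ / 2 := by
    rw [inv_eq_one_div, ← sub_nonneg]
    have : ξ⁻¹ + ξ / 2 - 1 = ((ξ - 1) ^ 2 + 1) / (2 * ξ) := by field_simp; ring
    rw [inv_eq_one_div] at this; rw [this]; positivity
  -- expand the left-hand side in the atoms `A, E, y, S, ξ`
  have expand : dphi c ξ + (c - ξ⁻¹ - ξ / 2) * phi c ξ + m * phi c ξ ^ 2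
      = -(A * E * (ξ⁻¹ + ξ / 2)) + (-(2 * y) / S ^ 3 - y / S) - 2 * ξ⁻¹ / S
        + m * (A * E + 2 / S) ^ 2 := by
    simp only [dphi, phi, ← hA_def, ← hE_def, ← hS_def, hy_def]; ring
  -- the quadratic term
  have hsq : m * (A * E + 2 / S) ^ 2 ≤ 2 * m * (A * E) ^ 2 + 8 * m / S ^ 2 := by
    have h : (A * E + 2 / S) ^ 2 ≤ 2 * (A * E) ^ 2 + 2 * (2 / S) ^ 2 := by
      nlinarith [sq_nonneg (A * E - 2 / S)]
    have := mul_le_mul_of_nonneg_left h hm0.le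
    have e : m * (2 * (A * E) ^ 2 + 2 * (2 / S) ^ 2) = 2 * m * (A * E) ^ 2 + 8 * m / S ^ 2 := by
      field_simp; ring
    linarith
  have hquad : 2 * m * (A * E) ^ 2 ≤ A * E / 8 := by
    -- `2m A² E² = A²E²/(8(A+2)) ≤ A E² / 8 ≤ A E / 8`
    have h1 : 2 * m * A ≤ 1 / 8 := by nlinarith
    have h2 : E ^ 2 ≤ E := by nlinarith
    calc 2 * m * (A * E) ^ 2 = (2 * m * A) * (A * E ^ 2) := by ring
      _ ≤ (1 / 8) * (A * E ^ 2) := by gcongr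
      _ ≤ (1 / 8) * (A * E) := by gcongr
      _ = A * E / 8 := by ring
  have hcross : 0 ≤ 2 * ξ⁻¹ / S := by positivity
  rw [expand]
  rcases le_or_gt 1 y with hy1 | hy1
  · -- region one
    have htail := tail_region_one hS0 hSy hy1 hm16
    have h78 : 0 ≤ ξ⁻¹ + ξ / 2 - 1 / 8 := by linarith
    have hAE0 : 0 ≤ A * E := by positivity
    have h1 := mul_nonneg hAE0 h78
    linarith
  · -- region two
    have htail := tail_region_two hS0 hSy hm32
    have hξle : ξ ≤ 2 * c + 1 := by rw [hy_def] at hy1; linarith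
    have hE8 : 8 ≤ A * E := by
      have hexp : exp (-(c * (2 * c + 1))) ≤ E := by
        rw [hE_def, exp_le_exp]; nlinarith
      have hprod : A * exp (-(c * (2 * c + 1))) = 8 := by
        rw [hA_def, bigA, mul_assoc, ← exp_add,
          show 2 * c ^ 2 + c + -(c * (2 * c + 1)) = 0 by ring, exp_zero, mul_one]
      nlinarith
    have h78 : 7 / 8 ≤ ξ⁻¹ + ξ / 2 - 1 / 8 := by linarith
    have hAE0 : 0 ≤ A * E := by positivity
    have h1 : A * E * (7 / 8) ≤ A * E * (ξ⁻¹ + ξ / 2 - 1 / 8) := mul_le_mul_of_nonneg_left h78 hAE0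
    have h2 : 8 * (7 / 8) ≤ A * E * (7 / 8) := by nlinarith
    linarith

end Summit.NavierStokesRegularity.NavierStokesRegularity.Theorems.ZhangBarrier

end
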